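import Mathlib
import Summits.AtomisticToContinuum.Crystallization.Theorems.ChessboardParticlePlanesLjLaminarWindowsGlueC5
import Summits.AtomisticToContinuum.Crystallization.Theorems.ChessboardParticlePlanesLjLaminarWindowsTripleShellA
import HarnessLib

/-! # Triple thick-sphere lemma — stub `stub_tripleShell` of line `Sketch` (skeleton rev. 14, lead c8),
crux `LjLaminarWindows` (stmt-AtomisticToContinuum-6711)

Three centres `a, b, c` pairwise at distance `≥ D` with `dist a c ≤ L/5` and `L ≤ K D`: the common part
of the three thick spheres `{L - R < |y - ·| ≤ L}` lies in two balls of radius `cr L` once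
`L ≥ L₃(cr, K) R`.  Pure Euclidean geometry in the frame of part A (`…TripleShellA`). -/

noncomputable section

open scoped BigOperators
open Filter Topology
open scoped InnerProductSpace
open Literature.MathematicalPhysics.StatisticalMechanics
open Summit.AtomisticToContinuum.Crystallization.Theorems.ChargedEnergyGapNegative

namespace Summit.AtomisticToContinuum.Crystallization.Theorems.LjLaminarWindowsSketch

/-- **Triple thick-sphere lemma (registered stub `stub_tripleShell` of line `Sketch`).** For
`cr > 0`, `K ≥ 1` there is `L₃` (here `1000 K³ / min(cr,1)²`) such that for `R ≥ 1`, `L ≥ L₃ R`,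
`L ≤ K D` and centres `a, b, c` pairwise at distance `≥ D` with `dist a c ≤ L / 5`, the common part of
the three thick spheres `{L - R < dist y · ≤ L}` lies in two balls of radius `cr L`.  Frame `(e, f, g)`
with `e ∥ b - a`, `c - m ∈ span (e, f)` (`m` the midpoint); far case (`w ≥ 40 K R / η²`): the two
reference points `m + γ f ± β g` (`tripleShell_far`); near case: the intersection is empty
(`tripleShell_near`). [folklore] -/
theorem stub_tripleShell :
    ∀ (cr K : ℝ), 0 < cr → 1 ≤ K → ∃ L₃ : ℝ, ∀ (L R D : ℝ), 1 ≤ R → L₃ * R ≤ L → L ≤ K * D →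
      ∀ (a b c : E3), D ≤ dist a b → D ≤ dist a c → D ≤ dist b c →
        dist a b ≤ L / 5 → dist a c ≤ L / 5 → dist b c ≤ L / 5 →
        ∃ y₁ y₂ : E3, ∀ y : E3,
          L - R < dist y a → dist y a ≤ L → L - R < dist y b → dist y b ≤ L →
          L - R < dist y c → dist y c ≤ L →
          dist y y₁ ≤ cr * L ∨ dist y y₂ ≤ cr * L := by
  intro cr K hcr hK
  obtain ⟨η, hη0, hη1, hηc⟩ : ∃ η : ℝ, 0 < η ∧ η ≤ 1 ∧ η ≤ cr :=
    ⟨min cr 1, lt_min hcr one_pos, min_le_right _ _, min_le_left _ _⟩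
  refine ⟨1000 * K ^ 3 / η ^ 2, ?_⟩
  intro L R D hR hL hLD a b c hab hac hbc _ hac' _
  have hK0 : 0 < K := by linarith
  have hR0 : 0 < R := by linarith
  obtain ⟨-, hL0, hRL, -, -⟩ := tripleShell_scale hK hη0 hη1 hR0 hL
  have hD0 : 0 < D := pos_of_mul_pos_right (hL0.trans_le hLD) hK0.le
  have hd0 : 0 < dist a b := hD0.trans_le hab
  -- the unit vector `e` of the line `a b` and the midpoint `m`
  obtain ⟨e, he_def⟩ : ∃ e : E3, (1 / dist a b) • (b - a) = e := ⟨_, rfl⟩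
  have he : ‖e‖ = 1 := by
    rw [← he_def, norm_smul, norm_div, norm_one, Real.norm_eq_abs, abs_of_pos hd0, ← dist_eq_norm,
      dist_comm b a, one_div_mul_cancel hd0.ne']
  have hde : b - a = dist a b • e := by
    rw [← he_def, smul_smul, mul_one_div_cancel hd0.ne', one_smul]
  obtain ⟨m, hm_def⟩ : ∃ m : E3, a + (dist a b / 2) • e = m := ⟨_, rfl⟩
  have hee : ⟪e, e⟫_ℝ = 1 := by rw [real_inner_self_eq_norm_sq, he, one_pow]
  obtain ⟨f, g, hef, heg, hfg, hff, hgg, hP, hqg, hqf⟩ := tripleShell_frame e (c - m) he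
  have hbm : b - m = (dist a b / 2) • e := by
    rw [← hm_def, ← sub_sub, hde, ← sub_smul, sub_half]
  have hya : ∀ y : E3, y - a = (y - m) + ((dist a b / 2) • e + (0 : ℝ) • f + (0 : ℝ) • g) := by
    intro y
    rw [zero_smul, zero_smul, add_zero, add_zero, ← hm_def]
    abel
  have hyb : ∀ y : E3, y - b = (y - m) + ((-(dist a b / 2)) • e + (0 : ℝ) • f + (0 : ℝ) • g) := by
    intro y
    rw [zero_smul, zero_smul, add_zero, add_zero, neg_smul, ← hbm]
    abel
  -- coordinates of `c`
  have hdac : dist a c ^ 2 = (⟪c - m, e⟫_ℝ + dist a b / 2) ^ 2 + ⟪c - m, f⟫_ℝ ^ 2 := by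
    rw [dist_comm a c, dist_eq_norm c a, hya c, tripleShell_coord hee hef heg hfg hff hgg hP, hqg]
    ring
  have hdbc : dist b c ^ 2 = (⟪c - m, e⟫_ℝ - dist a b / 2) ^ 2 + ⟪c - m, f⟫_ℝ ^ 2 := by
    rw [dist_comm b c, dist_eq_norm c b, hyb c, tripleShell_coord hee hef heg hfg hff hgg hP, hqg]
    ring
  have hca1 : D ^ 2 ≤ (⟪c - m, e⟫_ℝ + dist a b / 2) ^ 2 + ⟪c - m, f⟫_ℝ ^ 2 :=
    hdac ▸ pow_le_pow_left₀ hD0.le hac 2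
  have hca2 : (⟪c - m, e⟫_ℝ + dist a b / 2) ^ 2 + ⟪c - m, f⟫_ℝ ^ 2 ≤ (L / 5) ^ 2 :=
    hdac ▸ pow_le_pow_left₀ dist_nonneg hac' 2
  have hcb1 : D ^ 2 ≤ (⟪c - m, e⟫_ℝ - dist a b / 2) ^ 2 + ⟪c - m, f⟫_ℝ ^ 2 :=
    hdbc ▸ pow_le_pow_left₀ hD0.le hbc 2
  -- coordinates of a point `y` of the triple intersection
  have hLR : 0 ≤ L - R := by linarith
  have hY : ∀ y : E3, L - R < dist y a → dist y a ≤ L → L - R < dist y b → dist y b ≤ L →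
      L - R < dist y c → dist y c ≤ L →
      (L - R) ^ 2 < (⟪y - m, e⟫_ℝ + dist a b / 2) ^ 2 + ⟪y - m, f⟫_ℝ ^ 2 + ⟪y - m, g⟫_ℝ ^ 2 ∧
      (⟪y - m, e⟫_ℝ + dist a b / 2) ^ 2 + ⟪y - m, f⟫_ℝ ^ 2 + ⟪y - m, g⟫_ℝ ^ 2 ≤ L ^ 2 ∧
      (L - R) ^ 2 < (⟪y - m, e⟫_ℝ - dist a b / 2) ^ 2 + ⟪y - m, f⟫_ℝ ^ 2 + ⟪y - m, g⟫_ℝ ^ 2 ∧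
      (⟪y - m, e⟫_ℝ - dist a b / 2) ^ 2 + ⟪y - m, f⟫_ℝ ^ 2 + ⟪y - m, g⟫_ℝ ^ 2 ≤ L ^ 2 ∧
      (L - R) ^ 2 < (⟪y - m, e⟫_ℝ - ⟪c - m, e⟫_ℝ) ^ 2 + (⟪y - m, f⟫_ℝ - ⟪c - m, f⟫_ℝ) ^ 2 +
        ⟪y - m, g⟫_ℝ ^ 2 ∧
      (⟪y - m, e⟫_ℝ - ⟪c - m, e⟫_ℝ) ^ 2 + (⟪y - m, f⟫_ℝ - ⟪c - m, f⟫_ℝ) ^ 2 +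
        ⟪y - m, g⟫_ℝ ^ 2 ≤ L ^ 2 := by
    intro y h1 h2 h3 h4 h5 h6
    have hA : dist y a ^ 2 =
        (⟪y - m, e⟫_ℝ + dist a b / 2) ^ 2 + ⟪y - m, f⟫_ℝ ^ 2 + ⟪y - m, g⟫_ℝ ^ 2 := by
      rw [dist_eq_norm y a, hya y, tripleShell_coord hee hef heg hfg hff hgg hP]
      ring
    have hB : dist y b ^ 2 =
        (⟪y - m, e⟫_ℝ - dist a b / 2) ^ 2 + ⟪y - m, f⟫_ℝ ^ 2 + ⟪y - m, g⟫_ℝ ^ 2 := by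
      rw [dist_eq_norm y b, hyb y, tripleShell_coord hee hef heg hfg hff hgg hP]
      ring
    have hC : dist y c ^ 2 = (⟪y - m, e⟫_ℝ - ⟪c - m, e⟫_ℝ) ^ 2 +
        (⟪y - m, f⟫_ℝ - ⟪c - m, f⟫_ℝ) ^ 2 + ⟪y - m, g⟫_ℝ ^ 2 := by
      rw [dist_eq_norm y c, show y - c = (y - m) - (c - m) by abel, tripleShell_coord_sub hP, hqg]
      ring
    exact ⟨hA ▸ pow_lt_pow_left₀ h1 hLR two_ne_zero, hA ▸ pow_le_pow_left₀ dist_nonneg h2 2,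
      hB ▸ pow_lt_pow_left₀ h3 hLR two_ne_zero, hB ▸ pow_le_pow_left₀ dist_nonneg h4 2,
      hC ▸ pow_lt_pow_left₀ h5 hLR two_ne_zero, hC ▸ pow_le_pow_left₀ dist_nonneg h6 2⟩
  have hηL : η * L ≤ cr * L := mul_le_mul_of_nonneg_right hηc hL0.le
  by_cases hw : 40 * K * R / η ^ 2 ≤ ⟪c - m, f⟫_ℝ
  · -- FAR: two reference points `m + γ f ± β g`
    have hw0 : 0 < ⟪c - m, f⟫_ℝ := lt_of_lt_of_le (by positivity) hw
    obtain ⟨γ, hγ⟩ : ∃ γ : ℝ, γ * (2 * ⟪c - m, f⟫_ℝ) =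
        ⟪c - m, e⟫_ℝ ^ 2 + ⟪c - m, f⟫_ℝ ^ 2 - dist a b ^ 2 / 4 :=
      ⟨(⟪c - m, e⟫_ℝ ^ 2 + ⟪c - m, f⟫_ℝ ^ 2 - dist a b ^ 2 / 4) / (2 * ⟪c - m, f⟫_ℝ),
        div_mul_cancel₀ _ (by positivity)⟩
    obtain ⟨β, hβ⟩ : ∃ β : ℝ, β = Real.sqrt (L ^ 2 - dist a b ^ 2 / 4 - γ ^ 2) := ⟨_, rfl⟩
    refine ⟨m + (γ • f + β • g), m + (γ • f - β • g), fun y h1 h2 h3 h4 h5 h6 => ?_⟩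
    obtain ⟨hA1, hA2, hB1, hB2, hC1, hC2⟩ := hY y h1 h2 h3 h4 h5 h6
    have key := tripleShell_far hK hη0 hη1 hR0 hL hLD hab hca2 hA1 hA2 hB1 hB2 hC1 hC2 hw hγ hβ
    have hd1 : dist y (m + (γ • f + β • g)) ^ 2 =
        ⟪y - m, e⟫_ℝ ^ 2 + (⟪y - m, f⟫_ℝ - γ) ^ 2 + (⟪y - m, g⟫_ℝ - β) ^ 2 := by
      rw [dist_eq_norm, show y - (m + (γ • f + β • g)) =
          (y - m) + ((0 : ℝ) • e + (-γ) • f + (-β) • g) by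
            rw [zero_smul, zero_add, neg_smul, neg_smul]; abel,
        tripleShell_coord hee hef heg hfg hff hgg hP]
      ring
    have hd2 : dist y (m + (γ • f - β • g)) ^ 2 =
        ⟪y - m, e⟫_ℝ ^ 2 + (⟪y - m, f⟫_ℝ - γ) ^ 2 + (⟪y - m, g⟫_ℝ + β) ^ 2 := by
      rw [dist_eq_norm, show y - (m + (γ • f - β • g)) =
          (y - m) + ((0 : ℝ) • e + (-γ) • f + β • g) by
            rw [zero_smul, zero_add, neg_smul]; abel,
        tripleShell_coord hee hef heg hfg hff hgg hP]
      ring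
    rcases le_total 0 ⟪y - m, g⟫_ℝ with hs | hs
    · left
      rw [abs_of_nonneg hs] at key
      have h : dist y (m + (γ • f + β • g)) ^ 2 ≤ (η * L) ^ 2 := by rw [hd1]; linarith
      exact (le_of_sq_le_sq h (by positivity)).trans hηL
    · right
      rw [abs_of_nonpos hs] at key
      have h : dist y (m + (γ • f - β • g)) ^ 2 ≤ (η * L) ^ 2 := by rw [hd2]; linarith
      exact (le_of_sq_le_sq h (by positivity)).trans hηL
  · -- NEAR: the triple intersection is empty
    rw [not_le] at hw
    refine ⟨m, m, fun y h1 h2 h3 h4 h5 h6 => ?_⟩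
    obtain ⟨hA1, hA2, hB1, hB2, hC1, hC2⟩ := hY y h1 h2 h3 h4 h5 h6
    exact (tripleShell_near hK hη0 hη1 hR0 hL hLD hab hca1 hca2 hcb1 hA1 hA2 hB1 hB2 hC1 hC2
      hqf hw).elim

end Summit.AtomisticToContinuum.Crystallization.Theorems.LjLaminarWindowsSketch

end
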